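import Mathlib
import Summits.NavierStokesRegularity.NavierStokesRegularity.Theorems.OrthantWakeTwinSideBranch
import Summits.NavierStokesRegularity.NavierStokesRegularity.Theorems.SubOnsagerCeilingSideBranchWitness
import Literature.Analysis.FluidPDE.Tao2016AveragedNS.WeightedLatticeFlows
import HarnessLib

/-!
# The exact TWIN EMBEDDING of `α_SB` solutions into `twin-α_SB` solutions
(helper file for item stmt-NavierStokesRegularity-26438 `OrthantWake.ForwardHopWake`; `--supports`;
also serves the reductions for items 26608 and 26373)

For the side-branch dead-end table `α_SB = SubOnsagerCeiling.sideBranchTable` (lead's numerical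
witness against `OrthantTailCeiling`) and its all-source twin `twinSideBranchTable`
(`Theorems/OrthantWakeDefs.lean`), the linear map
`twinEmbed : (X_0, X_1, X_2, X_3) ↦ (X_0, X_1, (3/5)X_2, (4/5)X_2)` sends every solution of the
`ν`-viscous `α_SB` lattice on `[0,s]` to a solution of the `ν`-viscous `twin-α_SB` lattice
(`twinEmbed_hasDerivWithinAt`): the split feeds reproduce the `1/5` feed and its back-reaction
because `(3/5)² + (4/5)² = 1`, and the differential feed with its back-reactions vanishes identically
on `4X̃_2 = 3X̃_3` (`quadTerm_twin_twinEmbed`). One-shell data, the absence of low shells, Tao's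
(4.5) weight bound, continuity and non-negativity transfer; shell energies agree up to the inert
component `3` of `α_SB`, which only decays (`sideBranch_mode3_sq_le`), so tails above any shell
`m ≥ 1` coincide (`twinEmbed_tail_eq`).

Consequently the SYNTACTIC forward-source functional `Σ_{k≥n} Σ_{i∈S} ½X²`, `S ⊇ S⁺(α)`, of the
cruxes 26438 / 26608 / 26373 evaluates, on `twin-α_SB` (where `S = univ` is forced), to the TOTAL
tail energy of `α_SB` — whose `ν`-uniform decay is exactly what the dead-end numerics deny
(sibling reduction files).

HONEST FRAMING: elementary identities for a Tao-type MODEL lattice (rung TL-M2Break); no crux is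
proved or refuted here; nothing bears on Navier–Stokes regularity.
-/

noncomputable section

-- the sub-problem namespace `NavierStokesRegularity.NavierStokesRegularity` is the tree's layout (D-0017)
set_option linter.dupNamespace false

namespace Summit.NavierStokesRegularity.NavierStokesRegularity.Theorems

open Literature.Analysis.FluidPDE.TaoCascade

/-! ## The twin mixing and embedding: components and energies -/

/-- Components of `twinMix`. [this file] -/
theorem twinMix_apply (v : Fin 4 → ℝ) :
    twinMix v 0 = v 0 ∧ twinMix v 1 = v 1 ∧ twinMix v 2 = 3 / 5 * v 2 ∧ twinMix v 3 = 4 / 5 * v 2 := by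
  simp [twinMix]

/-- `twinMix 0 = 0`. [this file] -/
theorem twinMix_zero : twinMix (fun _ => (0 : ℝ)) = fun _ => 0 := by
  funext i
  fin_cases i <;> simp [twinMix]

/-- Energy of `twinMix v`: `Σ_i ½(twinMix v)_i² = Σ_i ½v_i² − ½v_3²` (`(3/5)² + (4/5)² = 1`). [this file] -/
theorem sum_sq_twinMix (v : Fin 4 → ℝ) :
    ∑ i : Fin 4, (1 / 2 : ℝ) * twinMix v i ^ 2 = (∑ i : Fin 4, (1 / 2 : ℝ) * v i ^ 2) - 1 / 2 * v 3 ^ 2 := by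
  simp only [Fin.sum_univ_four, twinMix]
  simp
  ring

/-- The differential feed is balanced on the image of `twinMix`: `4·(twinMix v)_2 = 3·(twinMix v)_3`.
[this file] -/
theorem twinMix_balanced (v : Fin 4 → ℝ) : 4 * twinMix v 2 - 3 * twinMix v 3 = 0 := by
  simp [twinMix]
  ring

/-- Components of `twinEmbed X`. [this file] -/
theorem twinEmbed_apply (X : Fin 4 → ℤ → ℝ → ℝ) (k : ℤ) (t : ℝ) :
    twinEmbed X 0 k t = X 0 k t ∧ twinEmbed X 1 k t = X 1 k t ∧
      twinEmbed X 2 k t = 3 / 5 * X 2 k t ∧ twinEmbed X 3 k t = 4 / 5 * X 2 k t := by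
  simp [twinEmbed, twinMix]

/-- Shell energies of `twinEmbed X`: `Σ_i ½X̃_{i,k}² = Σ_i ½X_{i,k}² − ½X_{3,k}²`. [this file] -/
theorem sum_sq_twinEmbed (X : Fin 4 → ℤ → ℝ → ℝ) (k : ℤ) (t : ℝ) :
    ∑ i : Fin 4, (1 / 2 : ℝ) * twinEmbed X i k t ^ 2 =
      (∑ i : Fin 4, (1 / 2 : ℝ) * X i k t ^ 2) - 1 / 2 * X 3 k t ^ 2 := by
  simp only [twinEmbed]
  exact sum_sq_twinMix (fun j => X j k t)

/-! ## The cascade nonlinearities of `α_SB` and of `twin-α_SB` along the embedding -/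

open Summit.NavierStokesRegularity.NavierStokesRegularity.Theorems.SubOnsagerCeiling in
/-- Closed form of the `α_SB` nonlinearity on each component: chain + pump back-reaction on `0`,
pump + feed back-reaction on `1`, the dead-end feed on `2`, nothing on `3`. [this file] -/
theorem quadTerm_sideBranchTable (ε₀ : ℝ) (X : Fin 4 → ℤ → ℝ → ℝ) (n : ℤ) (t : ℝ) :
    quadTerm ε₀ sideBranchTable X 0 n t =
        (1 + ε₀) ^ ((5 : ℝ) * ((n : ℝ) - 1) / 2) * X 0 (n - 1) t ^ 2 -
          (1 + ε₀) ^ ((5 : ℝ) * n / 2) * (X 0 n t * X 0 (n + 1) t + 1 / 5 * (X 0 n t * X 1 n t)) ∧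
      quadTerm ε₀ sideBranchTable X 1 n t =
        (1 + ε₀) ^ ((5 : ℝ) * n / 2) * (1 / 5 * X 0 n t ^ 2 - 1 / 5 * (X 1 n t * X 2 (n + 1) t)) ∧
      quadTerm ε₀ sideBranchTable X 2 n t =
        (1 + ε₀) ^ ((5 : ℝ) * ((n : ℝ) - 1) / 2) * (1 / 5 * X 1 (n - 1) t ^ 2) ∧
      quadTerm ε₀ sideBranchTable X 3 n t = 0 := by
  refine ⟨?_, ?_, ?_, ?_⟩ <;>
    simp only [quadTerm_four_shifts, Fin.sum_univ_four, sideBranchTable_feed, sideBranchTable_up1,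
      sideBranchTable_up2, sideBranchTable_inshell] <;>
    simp <;> first | ring1 | exact Or.inl (by ring1)

/-- Closed form of the `twin-α_SB` nonlinearity ALONG THE EMBEDDING `X̃ = twinEmbed X`: it is the
`α_SB` nonlinearity of `X` on components `0, 1`, and `3/5`, `4/5` of the `α_SB` feed on the twins —
the differential feed and its back-reactions vanish identically (`4X̃_2 = 3X̃_3`). [this file] -/
theorem quadTerm_twin_twinEmbed (ε₀ : ℝ) (X : Fin 4 → ℤ → ℝ → ℝ) (n : ℤ) (t : ℝ) :
    quadTerm ε₀ twinSideBranchTable (twinEmbed X) 0 n t =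
        quadTerm ε₀ SubOnsagerCeiling.sideBranchTable X 0 n t ∧
      quadTerm ε₀ twinSideBranchTable (twinEmbed X) 1 n t =
        quadTerm ε₀ SubOnsagerCeiling.sideBranchTable X 1 n t ∧
      quadTerm ε₀ twinSideBranchTable (twinEmbed X) 2 n t =
        3 / 5 * quadTerm ε₀ SubOnsagerCeiling.sideBranchTable X 2 n t ∧
      quadTerm ε₀ twinSideBranchTable (twinEmbed X) 3 n t =
        4 / 5 * quadTerm ε₀ SubOnsagerCeiling.sideBranchTable X 2 n t := by
  obtain ⟨h0, h1, h2, -⟩ := quadTerm_sideBranchTable ε₀ X n t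
  rw [h0, h1, h2]
  refine ⟨?_, ?_, ?_, ?_⟩ <;>
    simp only [quadTerm_four_shifts, Fin.sum_univ_four, twinSideBranchTable_feed,
      twinSideBranchTable_up1, twinSideBranchTable_up2, twinSideBranchTable_inshell, twinEmbed,
      twinMix] <;>
    simp <;> first | ring1 | exact Or.inl (by ring1)

/-! ## Solutions of the `α_SB` lattice embed as solutions of the `twin-α_SB` lattice -/

/-- **Solution transfer.** If `X` solves the `ν`-viscous `α_SB` lattice on `[0,s]` (one-sided
derivatives within `[0,s]`), then `twinEmbed X` solves the `ν`-viscous `twin-α_SB` lattice there.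
[this file] -/
theorem twinEmbed_hasDerivWithinAt {ε₀ ν s : ℝ} {X : Fin 4 → ℤ → ℝ → ℝ}
    (hder : ∀ (i : Fin 4) (k : ℤ), ∀ t ∈ Set.Icc (0 : ℝ) s, HasDerivWithinAt (X i k)
      (quadTerm ε₀ SubOnsagerCeiling.sideBranchTable X i k t - ν * (1 + ε₀) ^ ((2 : ℝ) * k) * X i k t)
      (Set.Icc (0 : ℝ) s) t) :
    ∀ (i : Fin 4) (k : ℤ), ∀ t ∈ Set.Icc (0 : ℝ) s, HasDerivWithinAt (twinEmbed X i k)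
      (quadTerm ε₀ twinSideBranchTable (twinEmbed X) i k t -
        ν * (1 + ε₀) ^ ((2 : ℝ) * k) * twinEmbed X i k t) (Set.Icc (0 : ℝ) s) t := by
  intro i k t ht
  obtain ⟨e0, e1, e2, e3⟩ := quadTerm_twin_twinEmbed ε₀ X k t
  have hf0 : twinEmbed X 0 k = X 0 k := by funext u; simp [twinEmbed, twinMix]
  have hf1 : twinEmbed X 1 k = X 1 k := by funext u; simp [twinEmbed, twinMix]
  have hf2 : twinEmbed X 2 k = fun u => 3 / 5 * X 2 k u := by funext u; simp [twinEmbed, twinMix]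
  have hf3 : twinEmbed X 3 k = fun u => 4 / 5 * X 2 k u := by funext u; simp [twinEmbed, twinMix]
  fin_cases i
  · simp only [Fin.zero_eta]  -- normalise the `Fin` literal
    rw [hf0, e0]
    exact hder 0 k t ht
  · simp only [Fin.mk_one]
    rw [hf1, e1]
    exact hder 1 k t ht
  · simp only [Fin.reduceFinMk]
    rw [hf2, e2]
    have h := (hder 2 k t ht).const_mul (3 / 5 : ℝ)
    refine h.congr_deriv ?_
    simp only []
    ring
  · simp only [Fin.reduceFinMk]
    rw [hf3, e3]
    have h := (hder 2 k t ht).const_mul (4 / 5 : ℝ)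
    refine h.congr_deriv ?_
    simp only []
    ring

/-- One-shell data transfer: the embedded trajectory starts from the mixed datum `twinMix X₀`.
[this file] -/
theorem twinEmbed_init {X : Fin 4 → ℤ → ℝ → ℝ} {X₀ : Fin 4 → ℝ}
    (hinit : ∀ (i : Fin 4) (k : ℤ), X i k 0 = if k = 0 then X₀ i else 0) :
    ∀ (i : Fin 4) (k : ℤ), twinEmbed X i k 0 = if k = 0 then twinMix X₀ i else 0 := by
  intro i k
  by_cases hk : k = 0
  · subst hk
    fin_cases i <;> simp [twinEmbed, twinMix, hinit]
  · fin_cases i <;> simp [twinEmbed, twinMix, hinit, hk]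

/-- No very low frequencies transfer. [this file] -/
theorem twinEmbed_low {X : Fin 4 → ℤ → ℝ → ℝ}
    (hlow : ∀ (i : Fin 4) (k : ℤ), k < 0 → ∀ t : ℝ, X i k t = 0) :
    ∀ (i : Fin 4) (k : ℤ), k < 0 → ∀ t : ℝ, twinEmbed X i k t = 0 := by
  intro i k hk t
  fin_cases i <;> simp [twinEmbed, twinMix, hlow _ k hk t]

/-- Tao's (4.5) weight bound transfers (the mixing coefficients have modulus `≤ 1`). [this file] -/
theorem twinEmbed_bound {ε₀ : ℝ} (hε : 0 < ε₀) {X : Fin 4 → ℤ → ℝ → ℝ} {M : ℝ}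
    (hM : ∀ (t : ℝ) (i : Fin 4) (k : ℤ), (1 + (1 + ε₀) ^ ((10 : ℝ) * k)) * |X i k t| ≤ M) :
    ∀ (t : ℝ) (i : Fin 4) (k : ℤ), (1 + (1 + ε₀) ^ ((10 : ℝ) * k)) * |twinEmbed X i k t| ≤ M := by
  intro t i k
  have hw : 0 ≤ 1 + (1 + ε₀) ^ ((10 : ℝ) * k) := by positivity
  have h2 := hM t 2 k
  fin_cases i
  · simpa [twinEmbed, twinMix] using hM t 0 k
  · simpa [twinEmbed, twinMix] using hM t 1 k
  · have : |(3 / 5 : ℝ) * X 2 k t| ≤ |X 2 k t| := by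
      rw [abs_mul, abs_of_pos (by norm_num : (0 : ℝ) < 3 / 5)]
      linarith [abs_nonneg (X 2 k t)]
    calc (1 + (1 + ε₀) ^ ((10 : ℝ) * k)) * |twinEmbed X 2 k t|
        = (1 + (1 + ε₀) ^ ((10 : ℝ) * k)) * |(3 / 5 : ℝ) * X 2 k t| := by simp [twinEmbed, twinMix]
      _ ≤ (1 + (1 + ε₀) ^ ((10 : ℝ) * k)) * |X 2 k t| := mul_le_mul_of_nonneg_left this hw
      _ ≤ M := h2
  · have : |(4 / 5 : ℝ) * X 2 k t| ≤ |X 2 k t| := by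
      rw [abs_mul, abs_of_pos (by norm_num : (0 : ℝ) < 4 / 5)]
      linarith [abs_nonneg (X 2 k t)]
    calc (1 + (1 + ε₀) ^ ((10 : ℝ) * k)) * |twinEmbed X 3 k t|
        = (1 + (1 + ε₀) ^ ((10 : ℝ) * k)) * |(4 / 5 : ℝ) * X 2 k t| := by simp [twinEmbed, twinMix]
      _ ≤ (1 + (1 + ε₀) ^ ((10 : ℝ) * k)) * |X 2 k t| := mul_le_mul_of_nonneg_left this hw
      _ ≤ M := h2

/-- Continuity transfers. [this file] -/
theorem twinEmbed_continuous {X : Fin 4 → ℤ → ℝ → ℝ} (hc : ∀ (i : Fin 4) (k : ℤ), Continuous (X i k)) :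
    ∀ (i : Fin 4) (k : ℤ), Continuous (twinEmbed X i k) := by
  intro i k
  have hf0 : twinEmbed X 0 k = X 0 k := by funext u; simp [twinEmbed, twinMix]
  have hf1 : twinEmbed X 1 k = X 1 k := by funext u; simp [twinEmbed, twinMix]
  have hf2 : twinEmbed X 2 k = fun u => 3 / 5 * X 2 k u := by funext u; simp [twinEmbed, twinMix]
  have hf3 : twinEmbed X 3 k = fun u => 4 / 5 * X 2 k u := by funext u; simp [twinEmbed, twinMix]
  fin_cases i
  · simp only [Fin.zero_eta]
    rw [hf0]
    exact hc 0 k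
  · simp only [Fin.mk_one]
    rw [hf1]
    exact hc 1 k
  · simp only [Fin.reduceFinMk]
    rw [hf2]
    exact continuous_const.mul (hc 2 k)
  · simp only [Fin.reduceFinMk]
    rw [hf3]
    exact continuous_const.mul (hc 2 k)

/-- Non-negativity on shells `≥ 1` transfers. [this file] -/
theorem twinEmbed_nonneg {s : ℝ} {X : Fin 4 → ℤ → ℝ → ℝ}
    (hpos : ∀ t ∈ Set.Icc (0 : ℝ) s, ∀ (i : Fin 4) (k : ℤ), 1 ≤ k → 0 ≤ X i k t) :
    ∀ t ∈ Set.Icc (0 : ℝ) s, ∀ (i : Fin 4) (k : ℤ), 1 ≤ k → 0 ≤ twinEmbed X i k t := by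
  intro t ht i k hk
  have h0 := hpos t ht 0 k hk; have h1 := hpos t ht 1 k hk; have h2 := hpos t ht 2 k hk
  fin_cases i <;> simp [twinEmbed, twinMix] <;> nlinarith


/-! ## Component `3` of an `α_SB` solution is inert -/

/-- If `x' = a` within `[0,s]` and `x·a ≤ 0` there, then `x(t)² ≤ x(0)²` on `[0,s]`. [this file] -/
theorem sq_le_sq_zero_of_hasDerivWithinAt {x a : ℝ → ℝ} {s : ℝ}
    (hx : ∀ t ∈ Set.Icc (0 : ℝ) s, HasDerivWithinAt x (a t) (Set.Icc (0 : ℝ) s) t)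
    (hxa : ∀ t ∈ Set.Icc (0 : ℝ) s, x t * a t ≤ 0) :
    ∀ t ∈ Set.Icc (0 : ℝ) s, x t ^ 2 ≤ x 0 ^ 2 := by
  intro t ht
  set B : ℝ → ℝ := fun w => x w ^ 2 with hB
  have hderB : ∀ w ∈ Set.Icc (0 : ℝ) s, HasDerivWithinAt B (2 * (x w * a w)) (Set.Icc 0 s) w := by
    intro w hw
    have h := (hx w hw).pow 2
    refine h.congr_deriv ?_
    rw [show (2 : ℕ) - 1 = 1 from rfl, pow_one]
    push_cast
    ring
  have hcont : ContinuousOn B (Set.Icc 0 s) := fun w hw => (hderB w hw).continuousWithinAt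
  have hdiff : DifferentiableOn ℝ B (interior (Set.Icc 0 s)) := by
    intro w hw
    rw [interior_Icc] at hw
    exact ((hderB w ⟨hw.1.le, hw.2.le⟩).hasDerivAt
      (Icc_mem_nhds hw.1 hw.2)).differentiableAt.differentiableWithinAt
  have hle : ∀ w ∈ interior (Set.Icc (0 : ℝ) s), deriv B w ≤ 0 := by
    intro w hw
    rw [interior_Icc] at hw
    rw [((hderB w ⟨hw.1.le, hw.2.le⟩).hasDerivAt (Icc_mem_nhds hw.1 hw.2)).deriv]
    have := hxa w ⟨hw.1.le, hw.2.le⟩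
    linarith
  have h := (convex_Icc (0 : ℝ) s).image_sub_le_mul_sub_of_deriv_le hcont hdiff hle 0
    ⟨le_rfl, ht.1.trans ht.2⟩ t ht ht.1
  have : B t ≤ B 0 := by linarith
  simpa only [hB] using this

/-- **Component `3` of an `α_SB` solution is inert**: along any solution of the `ν`-viscous `α_SB`
lattice on `[0,s]` from a one-shell datum `X₀`, `X_{3,k}(t)² ≤ X_{3,k}(0)²`, i.e. `X_{3,k} ≡ 0` for
`k ≠ 0` and `X_{3,0}(t)² ≤ (X₀ 3)²` (no coefficient of `α_SB` drives component `3`; it only decays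
viscously). [this file] -/
theorem sideBranch_mode3_sq_le {ε₀ ν s : ℝ} (hε : 0 < ε₀) (hν : 0 < ν) {X₀ : Fin 4 → ℝ}
    {X : Fin 4 → ℤ → ℝ → ℝ}
    (hinit : ∀ (i : Fin 4) (k : ℤ), X i k 0 = if k = 0 then X₀ i else 0)
    (hder : ∀ (i : Fin 4) (k : ℤ), ∀ t ∈ Set.Icc (0 : ℝ) s, HasDerivWithinAt (X i k)
      (quadTerm ε₀ SubOnsagerCeiling.sideBranchTable X i k t - ν * (1 + ε₀) ^ ((2 : ℝ) * k) * X i k t)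
      (Set.Icc (0 : ℝ) s) t) (k : ℤ) :
    ∀ t ∈ Set.Icc (0 : ℝ) s, X 3 k t ^ 2 ≤ (if k = 0 then X₀ 3 ^ 2 else 0) := by
  intro t ht
  have hνk : 0 ≤ ν * (1 + ε₀) ^ ((2 : ℝ) * k) :=
    mul_nonneg hν.le (Real.rpow_nonneg (by linarith) _)
  have h := sq_le_sq_zero_of_hasDerivWithinAt (x := X 3 k)
    (a := fun w => quadTerm ε₀ SubOnsagerCeiling.sideBranchTable X 3 k w -
      ν * (1 + ε₀) ^ ((2 : ℝ) * k) * X 3 k w) (hder 3 k) (fun w _ => by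
      rw [(quadTerm_sideBranchTable ε₀ X k w).2.2.2]
      nlinarith [mul_self_nonneg (X 3 k w), hνk]) t ht
  rw [hinit 3 k] at h
  by_cases hk : k = 0
  · simpa [hk] using h
  · simpa [hk] using h

/-- Consequence: on shells `k ≠ 0` the embedded trajectory has the same shell energy as `X`, and on
every shell the block sums of an `α_SB` solution exceed those of its embedding by at most
`½(X₀ 3)²`, placed on shell `0`. Precisely: for `t ∈ [0,s]`, naturals `n ≤ N` and any real `c`,
`Σ_{k=n..N} ½X_{3,k}(t)² ≤ ½(X₀ 3)²·(1+ε₀)^{-(c·n)}` (both sides vanish unless `n = 0`). [this file] -/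
theorem sideBranch_sum_mode3_le {ε₀ ν s : ℝ} (hε : 0 < ε₀) (hν : 0 < ν) {X₀ : Fin 4 → ℝ}
    {X : Fin 4 → ℤ → ℝ → ℝ}
    (hinit : ∀ (i : Fin 4) (k : ℤ), X i k 0 = if k = 0 then X₀ i else 0)
    (hder : ∀ (i : Fin 4) (k : ℤ), ∀ t ∈ Set.Icc (0 : ℝ) s, HasDerivWithinAt (X i k)
      (quadTerm ε₀ SubOnsagerCeiling.sideBranchTable X i k t - ν * (1 + ε₀) ^ ((2 : ℝ) * k) * X i k t)
      (Set.Icc (0 : ℝ) s) t)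
    (n N : ℕ) (c : ℝ) : ∀ t ∈ Set.Icc (0 : ℝ) s,
    ∑ k ∈ Finset.Icc n N, (1 / 2 : ℝ) * X 3 (k : ℤ) t ^ 2 ≤
      (1 / 2 : ℝ) * X₀ 3 ^ 2 * (1 + ε₀) ^ (-(c * (n : ℝ))) := by
  intro t ht
  have hterm : ∀ k : ℕ, (1 / 2 : ℝ) * X 3 (k : ℤ) t ^ 2 ≤
      if k = 0 then (1 / 2 : ℝ) * X₀ 3 ^ 2 else 0 := by
    intro k
    have h := sideBranch_mode3_sq_le hε hν hinit hder (k : ℤ) t ht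
    by_cases hk : k = 0
    · subst hk
      have hcond : ((0 : ℕ) : ℤ) = 0 := by simp
      rw [if_pos hcond] at h
      rw [if_pos rfl]
      simpa using h
    · have hcond : ¬ ((k : ℤ) = 0) := by exact_mod_cast hk
      rw [if_neg hcond] at h
      rw [if_neg hk]
      nlinarith [sq_nonneg (X 3 (k : ℤ) t)]
  by_cases hn : n = 0
  · subst hn
    have h1 : ∑ k ∈ Finset.Icc 0 N, (1 / 2 : ℝ) * X 3 (k : ℤ) t ^ 2 ≤
        ∑ k ∈ Finset.Icc 0 N, (if k = 0 then (1 / 2 : ℝ) * X₀ 3 ^ 2 else 0) :=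
      Finset.sum_le_sum fun k _ => hterm k
    rw [Finset.sum_ite_eq' (Finset.Icc 0 N) 0] at h1
    simp only [Finset.mem_Icc, le_refl, zero_le, and_self, if_true] at h1
    simpa using h1
  · have h0 : ∑ k ∈ Finset.Icc n N, (1 / 2 : ℝ) * X 3 (k : ℤ) t ^ 2 ≤ 0 := by
      refine Finset.sum_nonpos fun k hk => ?_
      have hk0 : k ≠ 0 := by
        have := (Finset.mem_Icc.1 hk).1; omega
      have := hterm k
      simp [hk0] at this
      nlinarith [sq_nonneg (X 3 (k : ℤ) t)]
    have hpos : 0 ≤ (1 / 2 : ℝ) * X₀ 3 ^ 2 * (1 + ε₀) ^ (-(c * (n : ℝ))) :=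
      mul_nonneg (by positivity) (Real.rpow_nonneg (by linarith) _)
    linarith

/-- Tails of the embedded trajectory above a shell `m ≥ 1` equal those of the `α_SB` solution.
[this file] -/
theorem twinEmbed_tail_eq {ε₀ ν s : ℝ} (hε : 0 < ε₀) (hν : 0 < ν) {X₀ : Fin 4 → ℝ}
    {X : Fin 4 → ℤ → ℝ → ℝ}
    (hinit : ∀ (i : Fin 4) (k : ℤ), X i k 0 = if k = 0 then X₀ i else 0)
    (hder : ∀ (i : Fin 4) (k : ℤ), ∀ t ∈ Set.Icc (0 : ℝ) s, HasDerivWithinAt (X i k)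
      (quadTerm ε₀ SubOnsagerCeiling.sideBranchTable X i k t - ν * (1 + ε₀) ^ ((2 : ℝ) * k) * X i k t)
      (Set.Icc (0 : ℝ) s) t)
    {m : ℕ} (hm : 1 ≤ m) {w : ℝ} (hw : w ∈ Set.Icc (0 : ℝ) s) :
    (∑' j : ℕ, ∑ i : Fin 4, (1 / 2 : ℝ) * twinEmbed X i ((m : ℕ) + (j : ℤ)) w ^ 2) =
      ∑' j : ℕ, ∑ i : Fin 4, (1 / 2 : ℝ) * X i ((m : ℕ) + (j : ℤ)) w ^ 2 := by
  refine tsum_congr fun j => ?_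
  rw [sum_sq_twinEmbed]
  have hk : ((m : ℕ) : ℤ) + (j : ℤ) ≠ 0 := by omega
  have h := sideBranch_mode3_sq_le hε hν hinit hder (((m : ℕ) : ℤ) + (j : ℤ)) w hw
  simp only [hk, if_false] at h
  have h0 : X 3 (((m : ℕ) : ℤ) + (j : ℤ)) w ^ 2 = 0 := le_antisymm h (sq_nonneg _)
  rw [h0]; ring

end Summit.NavierStokesRegularity.NavierStokesRegularity.Theorems

end
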